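import Mathlib
import Literature.RingTheory.MvPolynomial.GrobnerDegeneration
import Summits.ResolutionOfSingularities.ResolutionOfSingularities.Theorems.TropicalLinksSchonResolvesStandardIndependent
import Summits.ResolutionOfSingularities.ResolutionOfSingularities.Theorems.TropicalLinksSchonResolvesMapCSlice

/-!
# TropicalLinks / SchonResolves — the Gröbner degeneration of a variable-saturated ideal is
# variable-saturated

Route `ResolutionOfSingularities/TropicalLinks`, crux `SchonResolves`
(stmt-ResolutionOfSingularities-17234), line `zariski-toric-closure`, sub-brick (S1a) of the
flatness of the dehomogenised Gröbner family (Eisenbud, *Commutative Algebra*, §15.8,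
Thm. 15.17; several weights as in Maclagan–Sturmfels §2.4–2.5).  For an ideal `I ⊆ k[x_σ]`,
natural weights `W i : σ → ℕ` (`i : ι`) and the SHEAR `Φ : x^a ↦ t^{W·a} x^a`
(the `k[t]`-algebra endomorphism `MvPolynomial.aeval (fun s => C (t^{W_s}) * X s)` of
`k[t_ι][x_σ]`), with `I^e = I.map (map C)` the extension of `I` to `k[t][x]`:

* `schonResolves_shear_injective` — `Φ` is injective (`[x^a] Φ g = t^{W·a} [x^a] g`);
* `schonResolves_exists_shear_eq_C_monomial_mul` — every `r ∈ k[t][x]` has a `t`-monomial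
  multiple `t^D · r` in the image of `Φ`;
* `schonResolves_exists_mem_span_twist_of_mem_map` — for `h ∈ I^e` some `t^D · h` is the shear
  of a member of the ideal `⟨twist W f : f ∈ I⟩`;
* `schonResolves_mem_grobnerDegeneration_of_shear_mem_map` — hence the CONVERSE of
  `schonResolves_aeval_shear_mem_map_of_mem_grobnerDegeneration`:
  **`Φ g ∈ I^e → g ∈ grobnerDegeneration W I`**, so that
  `grobnerDegeneration W I = Φ⁻¹(I^e)`;
* `schonResolves_mem_map_map_C_of_X_mul_mem` — if `I` is saturated with respect to the variable
  `x_s` then so is `I^e` (read slice by slice in `k[x][t]`);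
* `schonResolves_grobnerDegeneration_saturated` (registered stub) — **if `I` is saturated with
  respect to every variable `x_s` then so is `grobnerDegeneration W I`**:
  `Φ (x_s g) = t^{W e_s} x_s Φ g`, and `I^e` is saturated with respect to `t`-monomials and to
  `x_s`.

Elementary; no new definitions.
-/

-- single-problem summit: the doubled namespace component `ResolutionOfSingularities` is forced
set_option linter.dupNamespace false

namespace Summit.ResolutionOfSingularities.ResolutionOfSingularities.Theorems

open MvPolynomial Finsupp Literature.RingTheory.MvPolynomial

section GrobnerSaturated

variable {k : Type} [Field k] {σ ι : Type}

/-- **The shear `Φ : x^a ↦ t^{W·a} x^a` is injective**: its effect on coefficients is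
multiplication by the monomial `t^{W·a}`. [folklore] -/
theorem schonResolves_shear_injective [Fintype ι] (W : ι → σ → ℕ)
    (g₁ g₂ : MvPolynomial σ (MvPolynomial ι k))
    (h : aeval (fun s : σ => C (monomial (equivFunOnFinite.symm fun i => W i s) (1 : k)) * X s)
        g₁ =
      aeval (fun s : σ => C (monomial (equivFunOnFinite.symm fun i => W i s) (1 : k)) * X s)
        g₂) :
    g₁ = g₂ := by
  classical
  refine MvPolynomial.ext _ _ fun a => MvPolynomial.ext _ _ fun e => ?_
  have h1 := congrArg
    (fun p => coeff (equivFunOnFinite.symm (fun i => weight (W i) a) + e) (coeff a p)) h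
  simpa only [schonResolves_coeff_shear, coeff_monomial_mul, one_mul] using h1

/-- Every `r ∈ k[t][x]` has a `t`-monomial multiple in the image of the shear:
`t^D · r = Φ q` for some exponent `D` and some `q` (for a term `c x^a` take `D = W·a`,
`q = c x^a`). [folklore] -/
theorem schonResolves_exists_shear_eq_C_monomial_mul [Fintype ι] (W : ι → σ → ℕ)
    (r : MvPolynomial σ (MvPolynomial ι k)) :
    ∃ (D : ι →₀ ℕ) (q : MvPolynomial σ (MvPolynomial ι k)),
      aeval (fun s : σ => C (monomial (equivFunOnFinite.symm fun i => W i s) (1 : k)) * X s)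
          q = C (monomial D (1 : k)) * r := by
  induction r using MvPolynomial.induction_on' with
  | monomial a c =>
    exact ⟨equivFunOnFinite.symm fun i => weight (W i) a, monomial a c, by
      rw [schonResolves_shear_monomial, C_mul_monomial]⟩
  | add p q hp hq =>
    obtain ⟨D₁, q₁, h₁⟩ := hp
    obtain ⟨D₂, q₂, h₂⟩ := hq
    refine ⟨D₁ + D₂, C (monomial D₂ (1 : k)) * q₁ + C (monomial D₁ (1 : k)) * q₂, ?_⟩
    have hmon : monomial (D₁ + D₂) (1 : k) = monomial D₁ 1 * monomial D₂ 1 := by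
      rw [monomial_mul, one_mul]
    rw [map_add, map_mul, map_mul, aeval_C, aeval_C, algebraMap_eq, h₁, h₂, hmon, map_mul]
    ring

/-- For `h` in the extended ideal `I^e = I.map (map C)`, some `t`-monomial multiple `t^D · h`
is the shear of a member of the ideal `⟨twist W f : f ∈ I⟩` generated by the twists
(`t^{μ(f)} · f = Φ (twist W f)`, and the image of `Φ` contains a `t`-monomial multiple of
every element). [folklore] -/
theorem schonResolves_exists_mem_span_twist_of_mem_map [Fintype ι] (W : ι → σ → ℕ)
    (I : Ideal (MvPolynomial σ k)) {h : MvPolynomial σ (MvPolynomial ι k)}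
    (hh : h ∈ I.map (MvPolynomial.map (C : k →+* MvPolynomial ι k))) :
    ∃ (D : ι →₀ ℕ) (p : MvPolynomial σ (MvPolynomial ι k)),
      p ∈ Ideal.span (twist W '' (I : Set (MvPolynomial σ k))) ∧
      aeval (fun s : σ => C (monomial (equivFunOnFinite.symm fun i => W i s) (1 : k)) * X s)
          p = C (monomial D (1 : k)) * h := by
  induction hh using Submodule.span_induction with
  | mem x hx =>
    obtain ⟨f, hf, rfl⟩ := hx
    exact ⟨equivFunOnFinite.symm fun i => weightedTotalDegree (W i) f, twist W f,
      Ideal.subset_span ⟨f, hf, rfl⟩, schonResolves_shear_twist W f⟩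
  | zero => exact ⟨0, 0, Ideal.zero_mem _, by rw [map_zero, mul_zero]⟩
  | add x y _ _ hx hy =>
    obtain ⟨D₁, p₁, hp₁, h₁⟩ := hx
    obtain ⟨D₂, p₂, hp₂, h₂⟩ := hy
    refine ⟨D₁ + D₂, C (monomial D₂ (1 : k)) * p₁ + C (monomial D₁ (1 : k)) * p₂,
      Ideal.add_mem _ (Ideal.mul_mem_left _ _ hp₁) (Ideal.mul_mem_left _ _ hp₂), ?_⟩
    have hmon : monomial (D₁ + D₂) (1 : k) = monomial D₁ 1 * monomial D₂ 1 := by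
      rw [monomial_mul, one_mul]
    rw [map_add, map_mul, map_mul, aeval_C, aeval_C, algebraMap_eq, h₁, h₂, hmon, map_mul]
    ring
  | smul r x _ hx =>
    obtain ⟨D, p, hp, h₁⟩ := hx
    obtain ⟨D', q, hq⟩ := schonResolves_exists_shear_eq_C_monomial_mul W r
    refine ⟨D' + D, q * p, Ideal.mul_mem_left _ _ hp, ?_⟩
    have hmon : monomial (D' + D) (1 : k) = monomial D' 1 * monomial D 1 := by
      rw [monomial_mul, one_mul]
    rw [map_mul, hq, h₁, smul_eq_mul, hmon, map_mul]
    ring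

/-- Every `t`-monomial `t^D` divides a power of `∏ tᵢ`: `(∏ tᵢ)^N = t^D · t^{D'}` with
`N = Σᵢ Dᵢ` and `D' = N·𝟙 − D`. [folklore] -/
theorem schonResolves_exists_prod_X_pow_eq_monomial_mul [Fintype ι] (D : ι →₀ ℕ) :
    ∃ (N : ℕ) (D' : ι →₀ ℕ),
      (∏ i, X i : MvPolynomial ι k) ^ N = monomial D (1 : k) * monomial D' 1 := by
  refine ⟨∑ i, D i, (∑ i, D i) • (∑ i, Finsupp.single i 1) - D, ?_⟩
  have hle : D ≤ (∑ i, D i) • (∑ i, Finsupp.single i (1 : ℕ) : ι →₀ ℕ) := by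
    refine Finsupp.le_def.mpr fun i => ?_
    rw [Finsupp.smul_apply, Finsupp.finsetSum_apply, Finsupp.univ_sum_single_apply',
      smul_eq_mul, mul_one]
    exact Finset.single_le_sum (fun j _ => Nat.zero_le (D j)) (Finset.mem_univ i)
  have hprod : (∏ i, X i : MvPolynomial ι k) = monomial (∑ i, Finsupp.single i 1) 1 :=
    (monomial_sum_one _ _).symm
  rw [hprod, monomial_pow, one_pow, monomial_mul, one_mul, add_tsub_cancel_of_le hle]

/-- **The converse of `schonResolves_aeval_shear_mem_map_of_mem_grobnerDegeneration`**: if the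
shear `Φ g` of `g ∈ k[t][x]` lies in the extended ideal `I^e = I.map (map C)`, then
`g ∈ grobnerDegeneration W I`.  Indeed `t^D · Φ g = Φ p` with `p ∈ ⟨twist W f : f ∈ I⟩`, so
`p = t^D · g` by injectivity of `Φ`, and `t^D` divides a power of `∏ tᵢ`.  Together with the
direct inclusion: `grobnerDegeneration W I = Φ⁻¹(I^e)`. [cite: Eisenbud1995, §15.8, Thm. 15.17
(proof)] -/
theorem schonResolves_mem_grobnerDegeneration_of_shear_mem_map [Fintype ι] (W : ι → σ → ℕ)
    (I : Ideal (MvPolynomial σ k)) (g : MvPolynomial σ (MvPolynomial ι k))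
    (hg : aeval (fun s : σ => C (monomial (equivFunOnFinite.symm fun i => W i s) (1 : k)) * X s)
        g ∈ I.map (MvPolynomial.map (C : k →+* MvPolynomial ι k))) :
    g ∈ grobnerDegeneration W I := by
  obtain ⟨D, p, hp, hΦ⟩ := schonResolves_exists_mem_span_twist_of_mem_map W I hg
  have hpg : p = C (monomial D (1 : k)) * g := by
    refine schonResolves_shear_injective W _ _ ?_
    rw [hΦ, map_mul, aeval_C, algebraMap_eq]
  obtain ⟨N, D', hN⟩ := schonResolves_exists_prod_X_pow_eq_monomial_mul (k := k) D
  have hC : (C (∏ i, X i : MvPolynomial ι k) : MvPolynomial σ (MvPolynomial ι k)) ^ N =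
      C (monomial D (1 : k)) * C (monomial D' 1) := by
    rw [← map_pow, hN, map_mul]
  refine ⟨N, ?_⟩
  rw [hC, ← mul_assoc, mul_comm g, ← hpg]
  exact Ideal.mul_mem_right _ _ hp

/-- If `I ⊆ k[x]` is saturated with respect to the variable `x_s` then so is its extension
`I^e = I.map (map C) ⊆ k[t][x]`: read in `k[x][t]`, the `t^e`-coefficient of `x_s · h` is
`x_s` times that of `h`, and membership in `I^e` is coefficientwise membership in `I`.
[folklore] -/
theorem schonResolves_mem_map_map_C_of_X_mul_mem (I : Ideal (MvPolynomial σ k))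
    (hI : ∀ (s : σ) (f : MvPolynomial σ k), X s * f ∈ I → f ∈ I) (s : σ)
    {h : MvPolynomial σ (MvPolynomial ι k)}
    (hh : X s * h ∈ I.map (MvPolynomial.map (C : k →+* MvPolynomial ι k))) :
    h ∈ I.map (MvPolynomial.map (C : k →+* MvPolynomial ι k)) := by
  rw [schonResolves_mem_map_map_C_iff_commAlgEquiv, mem_map_C_iff] at hh ⊢
  intro e
  have h1 := hh e
  rw [map_mul, commAlgEquiv_X, coeff_C_mul] at h1
  exact hI s _ h1

/-- **The Gröbner degeneration of a variable-saturated ideal is variable-saturated** (S1a of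
the flatness of the dehomogenised Gröbner family): if `x_s · f ∈ I → f ∈ I` for every variable
`x_s` and every `f ∈ k[x_σ]`, then `x_s · g ∈ grobnerDegeneration W I → g ∈
grobnerDegeneration W I` for every `g ∈ k[t_ι][x_σ]`.  Proof: with the shear
`Φ : x^a ↦ t^{W·a} x^a` one has `grobnerDegeneration W I = Φ⁻¹(I^e)`
(`schonResolves_aeval_shear_mem_map_of_mem_grobnerDegeneration` and
`schonResolves_mem_grobnerDegeneration_of_shear_mem_map`); now
`Φ (x_s g) = t^{W e_s} · x_s · Φ g ∈ I^e`, and `I^e` is saturated with respect to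
`t`-monomials and (by the hypothesis, slice by slice) to `x_s`, so `Φ g ∈ I^e`.
[cite: Eisenbud1995, §15.8, Thm. 15.17 (proof)] -/
theorem schonResolves_grobnerDegeneration_saturated : ∀ (k : Type) [Field k] (σ ι : Type)
    [Fintype ι] [DecidableEq ι] (W : ι → σ → ℕ) (I : Ideal (MvPolynomial σ k)),
    (∀ (s : σ) (f : MvPolynomial σ k), MvPolynomial.X s * f ∈ I → f ∈ I) →
      ∀ (s : σ) (g : MvPolynomial σ (MvPolynomial ι k)),
        MvPolynomial.X s * g ∈ Literature.RingTheory.MvPolynomial.grobnerDegeneration W I →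
          g ∈ Literature.RingTheory.MvPolynomial.grobnerDegeneration W I := by
  intro k _ σ ι _ _ W I hI s g hg
  have hΦ := schonResolves_aeval_shear_mem_map_of_mem_grobnerDegeneration k σ ι W I _ hg
  rw [map_mul, aeval_X, mul_assoc, mul_comm] at hΦ
  exact schonResolves_mem_grobnerDegeneration_of_shear_mem_map W I g
    (schonResolves_mem_map_map_C_of_X_mul_mem I hI s
      (schonResolves_mem_map_map_C_of_mul_C_monomial_mem I _ hΦ))

end GrobnerSaturated

end Summit.ResolutionOfSingularities.ResolutionOfSingularities.Theorems
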